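import Summits.ResolutionOfSingularities.ResolutionOfSingularities.Theorems.HilbertSamuelEliminationSigmaMaxModificationsCorridor3WLadderIsoKernelCPSliceIntegral
import Literature.AlgebraicGeometry.Resolution.BlowupDimension
import HarnessLib

/-!
# [OURS · L1 W4.2] THE ISO-KERNEL SLICE IN COSSART–PILTANT'S FRAME — ROW SHAPE: the hypotheses read off `IsMaximalOrigin p 3 ν (T.X 0) (pt 0)`
# (the binder of the registered kernel rows), so the slice plugs into `IdeasL1C5.IsoQuadraticTowerTerminates p 3`'s own quantifier shape

Crux chain w42 (`SigmaMaxModifications`, stmt-ResolutionOfSingularities-18506; conjunct `SigmaMaxModificationsCorridor3`, stmt-…-19249),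
line `w_ladder`, registered stubs `stub_isoInsepTower` / `stub_isoSepRecurrent`. Lead res-L1-w42-lead-1 (gen 5). Helper file
`--supports stmt-ResolutionOfSingularities-19249`; kernel only (no definition, no new named fact; CONDITIONAL on `CossartPiltant2019LocalPermissible`).

WHAT IS PROVED (`false_of_isIsoPointTower_pCyclic_of_maximalOrigin`). The kernel rows quantify `∀ ν T pt, IsMaximalOrigin p 3 ν (T.X 0) (pt 0) →
IsIsoPointTower 3 ν T pt → …`; this file derives the slice's bookkeeping hypotheses from `IsMaximalOrigin` itself (the field and the finite-type
structure map are its `exists_structure`; `dim 𝒪_{X_0,x_0} ≤ 3` from `dim X_0 ≤ 3` through `ringKrullDim_stalk_eq_coheight`), leaving exactly: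
`ν ≠ Φ^{(3)}`, `IsIntegral (T.X 0)`, and the identification of the origin stalk with Cossart–Piltant's germ (one injective `θ₀` whose image is a
local ring of `R[x]` containing `R` dominated). So: **`IsMaximalOrigin p 3 ν (T.X 0) (pt 0) → IsIsoPointTower 3 ν T pt → False`** for every such origin,
modulo the printed CP 2019 Thm. 1.5.

HONEST FRAMING. OURS bookkeeping; nothing here is a statement of H. Hironaka's manuscript [Hironaka2017] nor a new claim about [CossartPiltant2019].
AI-written; AI review is weaker than expert review.

References: V. Cossart, O. Piltant, J. Algebra 529 (2019), Thm. 1.5 [CossartPiltant2019]; V. Cossart, U. Jannsen, S. Saito, LNM 2270 (2020),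
Def. 6.38 [CossartJannsenSaito2020].
-/

noncomputable section

set_option linter.dupNamespace false

open Polynomial IsLocalRing AlgebraicGeometry CategoryTheory
open Literature.AlgebraicGeometry.Resolution Literature.AlgebraicGeometry.CossartJannsenSaito2020 Literature.RingTheory.HilbertSamuel
open Summit.ResolutionOfSingularities.ResolutionOfSingularities.Theorems.CampaignW42
open Summit.ResolutionOfSingularities.ResolutionOfSingularities.Cruxes.SigmaMaxModifications.IdeasL1Idea2R4 (IsIsoPointTower)

namespace Summit.ResolutionOfSingularities.ResolutionOfSingularities.Cruxes.SigmaMaxModifications.IdeasL1C5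

universe u

variable {L : Type u} [Field L]

/-- `dim 𝒪_{X,x} ≤ N` at every point of a scheme of dimension `≤ N`. [folklore] -/
theorem ringKrullDim_stalk_le_of_topologicalKrullDim_le {X : Scheme.{u}} {N : ℕ} (hX : topologicalKrullDim X ≤ (N : WithBot ℕ∞)) (x : X) :
    ringKrullDim (X.presheaf.stalk x) ≤ N := by
  rw [ringKrullDim_stalk_eq_coheight]
  exact_mod_cast (topologicalKrullDim_le_iff_forall_coheight_le X N).mp hX x

/-- **THE ISO-KERNEL SLICE IN COSSART–PILTANT'S FRAME, ROW SHAPE (modulo print)**: for a MAXIMAL ORIGIN `(T.X 0, pt 0)` of characteristic `p` at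
level `3` (`IsMaximalOrigin`, the binder of the registered kernel rows) that is integral, with `ν ≠ Φ^{(3)}`, whose stalk embeds into `L` as a local
ring of Cossart–Piltant's `p`-cyclic germ `R[x]` containing `R` dominated, there is NO isolated E3 point tower `IsIsoPointTower 3 ν T pt`.
CONDITIONAL on `CossartPiltant2019LocalPermissible`. [cite: CossartPiltant2019, Thm. 1.5 (arXiv v1: Thm. 1.4)] [cite: CossartJannsenSaito2020, Def. 6.38] -/
theorem false_of_isIsoPointTower_pCyclic_of_maximalOrigin (hCP : CossartPiltant2019LocalPermissible.{u})
    (p : ℕ) (hp : p.Prime) (R : Subring L) [IsRegularLocalRing R]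
    (hexc : IsExcellentRing R) (hdim : ringKrullDim R = 3) (hchar : CharP (ResidueField R) p)
    (h : R[X]) (x : L) (hmon : h.Monic) (hdeg : h.natDegree = p) (hx : aeval x h = 0)
    (hmin : ∀ g : R[X], g.natDegree < p → aeval x g = 0 → g = 0)
    (hgen : ∀ z : L, ∃ (g : R[X]) (s : R), s ≠ 0 ∧ z * s = aeval x g)
    (hcase : (CharP L p ∧ ∀ i, 0 < i → i < p → h.coeff i = 0) ∨
      (Nat.card (L ≃ₐ[R] L) = p ∧
        ∀ σ : L ≃ₐ[R] L, ∀ y ∈ Algebra.adjoin R ({x} : Set L), σ y ∈ Algebra.adjoin R ({x} : Set L)))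
    {ν : ℕ → ℕ} {T : BlowupTower.{u}} {pt : ∀ n, T.X n}
    (hO : IsMaximalOrigin p 3 ν (T.X 0) (pt 0)) (hν : ν ≠ iterPSum 3 Phi) [IsIntegral (T.X 0)]
    (hT : IsIsoPointTower 3 ν T pt)
    (θ₀ : (T.X 0).presheaf.stalk (pt 0) →+* L) (h₀ : Function.Injective θ₀)
    (hR0 : R ≤ θ₀.range) (hRdom : SubringDominates R θ₀.range)
    (hB : (Algebra.adjoin R ({x} : Set L)).toSubring ≤ θ₀.range)
    (hfrac : ∀ w ∈ θ₀.range, ∃ y ∈ (Algebra.adjoin R ({x} : Set L)).toSubring, ∃ z ∈ (Algebra.adjoin R ({x} : Set L)).toSubring,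
      z⁻¹ ∈ θ₀.range ∧ w = y / z) :
    False := by
  obtain ⟨k, _, _, g, -, hft, -⟩ := hO.exists_structure
  haveI := hft
  exact false_of_isIsoPointTower_pCyclic_of_CP_of_isIntegral hCP p hp R hexc hdim hchar h x hmon hdeg hx hmin hgen hcase hT g hν
    (ringKrullDim_stalk_le_of_topologicalKrullDim_le hO.dim_le (pt 0)) θ₀ h₀ hR0 hRdom hB hfrac

end Summit.ResolutionOfSingularities.ResolutionOfSingularities.Cruxes.SigmaMaxModifications.IdeasL1C5

end
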